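import Literature.NumberTheory.LFunctions.RepulsiveLogFreeDensitySingleModulus
import Literature.NumberTheory.LFunctions.RealCharacterLadderLeaves
import HarnessLib

/-!
# Thorner–Zaman's prime number theorem for progressions in the REGULAR case holds for every
# modulus on the certified range (PROVED only; debt 0)

Topic `Literature/NumberTheory/LFunctions`. Typed for the cell `parity-realchar` (SIEGEL INSTRUMENT):
a PROOF-OF-DATA consumer linking the certified leaves `NoRealZeroUpTo Q` (no real zero in `(0,1)`
for any primitive quadratic `χ` mod `3 ≤ q ≤ Q`; two-lineage certified at `Q = 10⁹`, `10¹⁰`, rung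
`3·10¹⁰`) to the dichotomy of Thorner–Zaman, Math. Z. 306 (2024), Theorem 1 / Corollary 5 (typed by
the cell `landau-siegel` in `RepulsiveLogFreeDensitySingleModulus.lean`): those theorems come in two
cases according to whether an «exceptional pair» `(β₁, χ₁)` modulo `q` exists
(`ThornerZaman2024PNTAP.ExceptionalPair χ₁ β₁`: `χ₁ ≠ 1` quadratic, a real zero
`β₁ ∈ [1 − 1/(50 log q), 1)` of `L(s, χ₁)`). On the certified range the exceptional case is VOID —
also for imprimitive `χ₁` (the wide leaf controls every quadratic non-principal character,
`NoRealZeroUpTo.lfunction_ne_zero`) — so the REGULAR case (`λ = 1`, no Siegel correction) is in force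
for every modulus `q ≤ Q`:

* `NoRealZeroUpTo.not_exceptionalPair` / `.noExceptionalPair` — under `NoRealZeroUpTo Q`, no
  modulus `2 ≤ q ≤ Q` carries an exceptional pair;
* `NoRealZeroUpTo.thetaAP_of_corollary5_regular` — modulo the named fact
  `thornerZaman2024PNTAP_corollary5_regular`: absolute effective `c > 0`, `K ≥ 0` with
  `|∑_{p ≤ x, p ≡ a (q)} log p − x/φ(q)| ≤ K (x/φ(q)) (exp(−c log x/log q) + exp(−c (log x)^{3/5}(log log x)^{−1/5}))`
  for EVERY `2 ≤ q ≤ Q`, `(a,q) = 1`, `x ≥ 3` with `x/φ(q) ≥ x^{18/19}`;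
* `NoRealZeroUpTo.thetaShortAP_of_theorem1_regular` — the same for the short-interval Theorem 1
  (regular case, `θ = 7/12 + ε`);
* instances on the cell's leaves (certified numerics; value-free for the rung until routes F/G
  book): `thetaAP_upTo_1e10_of_leaf` (`NoRealZeroUpTo_1e10`: every modulus `q ≤ 10¹⁰`),
  `thetaAP_upTo_3e10_of_leaf` (`NoRealZeroUpTo_3e10`).

In words: the certified table turns Thorner–Zaman's dichotomy into its good branch for all
`q ≤ 10¹⁰` — the «illusory» secondary main term `−χ₁(a)(x^{β₁} − (x−h)^{β₁})/(β₁φ(q))` of the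
exceptional case (`thornerZaman2024PNTAP_theorem1_exceptional`, read on `IsSiegelZero` in
`SiegelZeroPredicateDictionary.lean`) can only occur at moduli `q > 10¹⁰`.

LABEL (cell rule): instrument / proof-of-data consumer (kernel glue over a named fact and a
certified leaf). WHAT THIS IS NOT: the Thorner–Zaman theorems themselves are named facts (not proved
here); the leaves are statements of record discharged by certified computation, not by the kernel;
nothing here bears on the parity summit.

## References

* [ThornerZaman2024PNTAP] J. Thorner, A. Zaman, *Refinements to the prime number theorem for
  arithmetic progressions*, Math. Z. 306 (2024) — §1 (the exceptional pair), Theorem 1, Corollary 5.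
* [Platt2016GRH] D. J. Platt, Math. Comp. 85 (2016), Theorems 7.1–7.2 (the print anchor of the wide
  leaves `NoRealZeroUpTo`).
-/

noncomputable section

namespace Literature.NumberTheory.LFunctions

open ThornerZaman2024PNTAP

/-! ### No exceptional pair on the certified range -/

/-- **Under the wide leaf `NoRealZeroUpTo Q`, no modulus `2 ≤ q ≤ Q` has an exceptional pair**
(Thorner–Zaman's `(β₁, χ₁)`, primitive or not): `β₁ ≥ 1 − 1/(50 log q) > 0` (`log q ≥ log 2 > 1/50`)
and `β₁ < 1`, while the leaf gives `L(σ, χ₁) ≠ 0` for every quadratic `χ₁ ≠ 1` mod `q ≤ Q` and every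
`σ > 0` (`NoRealZeroUpTo.lfunction_ne_zero`, imprimitive characters included).
[cite: ThornerZaman2024PNTAP, §1 (paragraph before Theorem 1: the exceptional pair (β₁, χ₁))]
[cite: Platt2016GRH, Theorems 7.1 and 7.2] -/
theorem NoRealZeroUpTo.not_exceptionalPair {Q : ℕ} (hW : NoRealZeroUpTo Q) {q : ℕ} [NeZero q]
    (hq : 2 ≤ q) (hqQ : q ≤ Q) (χ : DirichletCharacter ℂ q) (β : ℝ) : ¬ ExceptionalPair χ β := by
  rintro ⟨hne, hquad, hβlo, _, hzero⟩
  have hq2 : (2 : ℝ) ≤ q := by exact_mod_cast hq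
  have hlog : Real.log 2 ≤ Real.log q := Real.log_le_log (by norm_num) hq2
  have hlog2 : (0.6931471803 : ℝ) < Real.log 2 := Real.log_two_gt_d9
  have hlogq : 0 < Real.log q := by linarith
  -- `1/(50 log q) < 1`, so `β > 0`
  have hsmall : 1 / (50 * Real.log q) < 1 := by
    rw [div_lt_one (by positivity)]
    linarith
  have hβpos : 0 < β := by linarith
  exact hW.lfunction_ne_zero hqQ χ hquad hne hβpos hzero

/-- The hypothesis of Thorner–Zaman's REGULAR case, for every modulus `2 ≤ q ≤ Q` under the wide
leaf. [cite: ThornerZaman2024PNTAP, Theorem 1 (case "(β₁,χ₁) does not exist")] [cite: Platt2016GRH, Theorems 7.1 and 7.2] -/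
theorem NoRealZeroUpTo.noExceptionalPair {Q : ℕ} (hW : NoRealZeroUpTo Q) {q : ℕ} [NeZero q]
    (hq : 2 ≤ q) (hqQ : q ≤ Q) :
    ∀ (χ₁ : DirichletCharacter ℂ q) (β₁ : ℝ), ¬ ExceptionalPair χ₁ β₁ :=
  fun χ₁ β₁ => hW.not_exceptionalPair hq hqQ χ₁ β₁

/-! ### The regular-case prime number theorems on the certified range -/

/-- **Corollary 5 (regular case) for EVERY modulus `q ≤ Q` under the wide leaf** (modulo the named
fact `thornerZaman2024PNTAP_corollary5_regular`): absolute effective `c > 0`, `K ≥ 0` such that for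
`2 ≤ q ≤ Q`, `(a,q) = 1`, `x ≥ 3` with `x/φ(q) ≥ x^{18/19}`,
`|∑_{p ≤ x, p ≡ a (q)} log p − x/φ(q)| ≤ K (x/φ(q)) (exp(−c log x/log q) + exp(−c (log x)^{3/5}(log log x)^{−1/5}))`
— no Siegel correction anywhere on the range.
[cite: ThornerZaman2024PNTAP, Corollary 5 p.4 (case λ = 1)] [cite: Platt2016GRH, Theorems 7.1 and 7.2] -/
theorem NoRealZeroUpTo.thetaAP_of_corollary5_regular {Q : ℕ} (hW : NoRealZeroUpTo Q)
    (h5 : thornerZaman2024PNTAP_corollary5_regular) :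
    ∃ c : ℝ, 0 < c ∧ ∃ K : ℝ, 0 ≤ K ∧
      ∀ (q : ℕ) [NeZero q], 2 ≤ q → q ≤ Q → ∀ (a : ZMod q), IsUnit a → ∀ x : ℝ, 3 ≤ x →
        x ^ ((18 : ℝ) / 19) ≤ x / Nat.totient q →
          |thetaShortAP q a x x - x / Nat.totient q| ≤
            K * (x / Nat.totient q) *
              (Real.exp (-c * Real.log x / Real.log q) +
                Real.exp (-c * Real.log x ^ ((3 : ℝ) / 5) / Real.log (Real.log x) ^ ((1 : ℝ) / 5))) := by
  obtain ⟨c, hc, K, hK, h⟩ := h5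
  exact ⟨c, hc, K, hK, fun q _ hq hqQ a ha x hx hrange =>
    h q hq (hW.noExceptionalPair hq hqQ) a ha x hx hrange⟩

/-- **Theorem 1 (regular case, short intervals, `θ = 7/12 + ε`) for EVERY modulus `q ≤ Q` under the
wide leaf** (modulo the named fact `thornerZaman2024PNTAP_theorem1_regular`): for `0 < ε < 5/12`
there are effective `c > 0`, `K ≥ 0` such that for `2 ≤ q ≤ Q`, `(a,q) = 1`, `4 ≤ h ≤ x` with
`h/φ(q) ≥ x^{7/12+ε}`:
`|∑_{x−h < p ≤ x, p ≡ a (q)} log p − h/φ(q)| ≤ K (h/φ(q)) exp(−c log x/(log q + (log(x/h))^{2/3}(log⁺log(x/h))^{1/3} + (log x)^{2/5}(log log x)^{1/5}))`.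
[cite: ThornerZaman2024PNTAP, Theorem 1 p.3 (case λ = 1)] [cite: Platt2016GRH, Theorems 7.1 and 7.2] -/
theorem NoRealZeroUpTo.thetaShortAP_of_theorem1_regular {Q : ℕ} (hW : NoRealZeroUpTo Q)
    (h1 : thornerZaman2024PNTAP_theorem1_regular) {ε : ℝ} (hε : 0 < ε) (hε' : ε < 1 - 7 / 12) :
    ∃ c : ℝ, 0 < c ∧ ∃ K : ℝ, 0 ≤ K ∧
      ∀ (q : ℕ) [NeZero q], 2 ≤ q → q ≤ Q → ∀ (a : ZMod q), IsUnit a → ∀ (x h : ℝ), 4 ≤ h → h ≤ x →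
        x ^ (7 / 12 + ε) ≤ h / Nat.totient q →
          |thetaShortAP q a x h - h / Nat.totient q| ≤
            K * (h / Nat.totient q) * Real.exp (-c * Real.log x / errDenom q x h) := by
  obtain ⟨c, hc, K, hK, h⟩ := h1 ε hε hε'
  exact ⟨c, hc, K, hK, fun q _ hq hqQ a ha x hh h4 hhx hrange =>
    h q hq (hW.noExceptionalPair hq hqQ) a ha x hh h4 hhx hrange⟩

/-! ### Instances on the cell's certified leaves -/

/-- **Decade instance (`Q = 10¹⁰`, CERTIFIED NUMERICS: the wide leaf `NoRealZeroUpTo_1e10` of the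
cell, two-lineage, both parities booked 2026-08-26).** Modulo Thorner–Zaman's Corollary 5 (regular
case): the regular prime number theorem for progressions holds, with NO Siegel correction, for EVERY
modulus `2 ≤ q ≤ 10¹⁰`. [cite: ThornerZaman2024PNTAP, Corollary 5 p.4 (case λ = 1)]
[cite: Platt2016GRH, Theorems 7.1 and 7.2] -/
theorem thetaAP_upTo_1e10_of_leaf (hW : NoRealZeroUpTo_1e10)
    (h5 : thornerZaman2024PNTAP_corollary5_regular) :
    ∃ c : ℝ, 0 < c ∧ ∃ K : ℝ, 0 ≤ K ∧
      ∀ (q : ℕ) [NeZero q], 2 ≤ q → q ≤ 10000000000 → ∀ (a : ZMod q), IsUnit a → ∀ x : ℝ, 3 ≤ x →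
        x ^ ((18 : ℝ) / 19) ≤ x / Nat.totient q →
          |thetaShortAP q a x x - x / Nat.totient q| ≤
            K * (x / Nat.totient q) *
              (Real.exp (-c * Real.log x / Real.log q) +
                Real.exp (-c * Real.log x ^ ((3 : ℝ) / 5) / Real.log (Real.log x) ^ ((1 : ℝ) / 5))) :=
  NoRealZeroUpTo.thetaAP_of_corollary5_regular hW h5

/-- **Rung instance (`Q = 3·10¹⁰`, the wide rung leaf `NoRealZeroUpTo_3e10`; value-free until routes
F and G book).** [cite: ThornerZaman2024PNTAP, Corollary 5 p.4 (case λ = 1)]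
[cite: Platt2016GRH, Theorems 7.1 and 7.2] -/
theorem thetaAP_upTo_3e10_of_leaf (hW : NoRealZeroUpTo_3e10)
    (h5 : thornerZaman2024PNTAP_corollary5_regular) :
    ∃ c : ℝ, 0 < c ∧ ∃ K : ℝ, 0 ≤ K ∧
      ∀ (q : ℕ) [NeZero q], 2 ≤ q → q ≤ 30000000000 → ∀ (a : ZMod q), IsUnit a → ∀ x : ℝ, 3 ≤ x →
        x ^ ((18 : ℝ) / 19) ≤ x / Nat.totient q →
          |thetaShortAP q a x x - x / Nat.totient q| ≤
            K * (x / Nat.totient q) *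
              (Real.exp (-c * Real.log x / Real.log q) +
                Real.exp (-c * Real.log x ^ ((3 : ℝ) / 5) / Real.log (Real.log x) ^ ((1 : ℝ) / 5))) :=
  NoRealZeroUpTo.thetaAP_of_corollary5_regular hW h5

/-- **No exceptional pair below `10¹⁰`** (leaf instance): Thorner–Zaman's exceptional case — the
«illusory» secondary main term — can only occur at moduli `q > 10¹⁰`.
[cite: ThornerZaman2024PNTAP, §1 (the exceptional pair (β₁, χ₁))] [cite: Platt2016GRH, Theorems 7.1 and 7.2] -/
theorem not_exceptionalPair_upTo_1e10_of_leaf (hW : NoRealZeroUpTo_1e10) {q : ℕ} [NeZero q]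
    (hq : 2 ≤ q) (hqQ : q ≤ 10000000000) (χ : DirichletCharacter ℂ q) (β : ℝ) :
    ¬ ExceptionalPair χ β :=
  NoRealZeroUpTo.not_exceptionalPair hW hq hqQ χ β

end Literature.NumberTheory.LFunctions

end
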